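import Literature.Combinatorics.Enumerative.PermanentLaplaceExpansion
import HarnessLib

/-!
# The Laplace expansion of a permanent along three blocks of rows

Topic `Literature/Combinatorics/Enumerative`.  Companion of `PermanentLaplaceExpansion.lean`
(two blocks `P ⊔ Pᶜ`).  For a square matrix `A` over a commutative semiring indexed by a finite
type `ι` and two DISJOINT sets of rows `B₀, B₁` (third block `(B₀ ∪ B₁)ᶜ`),

  `per A = ∑_{S, T disjoint, |S| = |B₀|, |T| = |B₁|} per A[B₀, S] · per A[B₁, T] · per A[(B₀ ∪ B₁)ᶜ, (S ∪ T)ᶜ]`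

— the Laplace expansion along the ordered row partition `B₀ ⊔ B₁ ⊔ (B₀ ∪ B₁)ᶜ` (Minc,
*Permanents*, Ch. 2, Thm. 1.2, iterated once).  As in the two-block file the minors are written as
sign-free bijection sums `∑_{b : B ≃ S} ∏_{p ∈ B} A p (b p)` (identified with honest permanents of
submatrices by `sum_equiv_prod_eq_permanent_submatrix` there).  This is the shape consumed by the
three-row-block expansion `per_{3k} = Σ_{S ⊔ T ⊔ U} per[B₀,S] · per[B₁,T] · per[B₂,U]` of route
`RyserTripartition` of the `ValiantsHypothesis` tree (item `PerLeTripartition`).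

Proof: sort the permutations `σ` in `per A = ∑_σ ∏_i A i (σ i)` by the PAIR of images
`(σ(B₀), σ(B₁))` (`Finset.sum_fiberwise_of_maps_to`) and identify each fibre with
`(B₀ ≃ S) × (B₁ ≃ T) × ((B₀ ∪ B₁)ᶜ ≃ (S ∪ T)ᶜ)` by restriction / gluing (`Finset.sum_bij'`).
No new definitions.

## References

* [Minc1978] H. Minc, *Permanents*, Encyclopedia of Mathematics and its Applications 6,
  Addison-Wesley 1978, Ch. 2 §2.1, Thm. 1.2 (Laplace expansion theorem for permanents).
-/

namespace Literature.Combinatorics.Enumerative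

open Finset Matrix

variable {ι : Type*} {R : Type*} [CommSemiring R]

/-- For a permutation `σ` with `σ(B) = S`: `σ i ∈ S ↔ i ∈ B`. [folklore] -/
private theorem perm_mem_iff_of_map_eq {B S : Finset ι} {σ : Equiv.Perm ι}
    (h : B.map σ.toEmbedding = S) (i : ι) : σ i ∈ S ↔ i ∈ B := by
  rw [← h]; simp

/-- **Laplace expansion of the permanent along three row blocks** `B₀ ⊔ B₁ ⊔ (B₀ ∪ B₁)ᶜ`
(Minc, *Permanents*, Ch. 2 Thm. 1.2, iterated): for disjoint row sets `B₀, B₁`,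
`per A = ∑_{|S| = |B₀|} ∑_{|T| = |B₁|, S ∩ T = ∅} per A[B₀,S] · per A[B₁,T] · per A[(B₀∪B₁)ᶜ, (S∪T)ᶜ]`,
minors as sign-free bijection sums. [cite: Minc1978, Ch. 2, Thm. 1.2] -/
theorem permanent_eq_sum_sum_threeBlocks [Fintype ι] [DecidableEq ι] (A : Matrix ι ι R)
    {B₀ B₁ : Finset ι} (hB : Disjoint B₀ B₁) :
    A.permanent =
      ∑ S ∈ (Finset.univ : Finset ι).powersetCard B₀.card,
        ∑ T ∈ ((Finset.univ : Finset ι).powersetCard B₁.card).filter (fun T => Disjoint S T),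
          (∑ b : ↥B₀ ≃ ↥S, ∏ p : ↥B₀, A p (b p)) *
            (∑ b : ↥B₁ ≃ ↥T, ∏ p : ↥B₁, A p (b p)) *
              (∑ b : ↥((B₀ ∪ B₁)ᶜ) ≃ ↥((S ∪ T)ᶜ), ∏ p : ↥((B₀ ∪ B₁)ᶜ), A p (b p)) := by
  classical
  -- Step 1: the iterated sum over disjoint pairs as ONE sum over a filtered product finset.
  set PC₀ := (Finset.univ : Finset ι).powersetCard B₀.card with hPC₀
  set PC₁ := (Finset.univ : Finset ι).powersetCard B₁.card with hPC₁
  set D := (PC₀ ×ˢ PC₁).filter (fun ST : Finset ι × Finset ι => Disjoint ST.1 ST.2) with hDdef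
  set F : Finset ι × Finset ι → R := fun ST =>
    (∑ b : ↥B₀ ≃ ↥ST.1, ∏ p : ↥B₀, A p (b p)) *
      (∑ b : ↥B₁ ≃ ↥ST.2, ∏ p : ↥B₁, A p (b p)) *
        (∑ b : ↥((B₀ ∪ B₁)ᶜ) ≃ ↥((ST.1 ∪ ST.2)ᶜ), ∏ p : ↥((B₀ ∪ B₁)ᶜ), A p (b p)) with hFdef
  have hiter : (∑ S ∈ PC₀, ∑ T ∈ PC₁.filter (fun T => Disjoint S T), F (S, T)) =
      ∑ ST ∈ D, F ST := by
    rw [hDdef, Finset.sum_filter, Finset.sum_product]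
    refine Finset.sum_congr rfl fun S _ => ?_
    rw [Finset.sum_filter]
  change A.permanent = ∑ S ∈ PC₀, ∑ T ∈ PC₁.filter (fun T => Disjoint S T), F (S, T)
  rw [hiter, ← sum_perm_prod_apply_eq_permanent]
  -- Step 2: sort the permutations by `(σ(B₀), σ(B₁))`.
  have hmaps : ∀ σ ∈ (Finset.univ : Finset (Equiv.Perm ι)),
      (B₀.map σ.toEmbedding, B₁.map σ.toEmbedding) ∈ D := fun σ _ => by
    simp only [hDdef, hPC₀, hPC₁, Finset.mem_filter, Finset.mem_product,
      Finset.mem_powersetCard, Finset.card_map, Finset.subset_univ, true_and, and_self]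
    exact (Finset.disjoint_map σ.toEmbedding).2 hB
  rw [← Finset.sum_fiberwise_of_maps_to hmaps]
  refine Finset.sum_congr rfl fun ST hST => ?_
  obtain ⟨S, T⟩ := ST
  have hSTdisj : Disjoint S T := (Finset.mem_filter.mp hST).2
  -- Step 3: the fibre over `(S, T)` versus triples of bijections.
  simp only [hFdef]
  rw [Finset.sum_mul_sum, ← Finset.sum_product', Finset.sum_mul_sum, ← Finset.sum_product']
  -- gluing three bijections into a permutation
  let glueFun : ((↥B₀ ≃ ↥S) × (↥B₁ ≃ ↥T)) × (↥((B₀ ∪ B₁)ᶜ) ≃ ↥((S ∪ T)ᶜ)) → ι → ι :=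
    fun bbb i =>
      if h₀ : i ∈ B₀ then (bbb.1.1 ⟨i, h₀⟩ : ι)
      else if h₁ : i ∈ B₁ then (bbb.1.2 ⟨i, h₁⟩ : ι)
      else (bbb.2 ⟨i, by rw [Finset.mem_compl, Finset.mem_union]; exact not_or.mpr ⟨h₀, h₁⟩⟩ : ι)
  let glueInv : ((↥B₀ ≃ ↥S) × (↥B₁ ≃ ↥T)) × (↥((B₀ ∪ B₁)ᶜ) ≃ ↥((S ∪ T)ᶜ)) → ι → ι :=
    fun bbb j =>
      if h₀ : j ∈ S then (bbb.1.1.symm ⟨j, h₀⟩ : ι)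
      else if h₁ : j ∈ T then (bbb.1.2.symm ⟨j, h₁⟩ : ι)
      else (bbb.2.symm ⟨j, by rw [Finset.mem_compl, Finset.mem_union]; exact not_or.mpr ⟨h₀, h₁⟩⟩ : ι)
  have hB₁₀ : ∀ {i}, i ∈ B₁ → i ∉ B₀ := fun h₁ h₀ => Finset.disjoint_left.mp hB h₀ h₁
  have hT₀ : ∀ {j}, j ∈ T → j ∉ S := fun h₁ h₀ => Finset.disjoint_left.mp hSTdisj h₀ h₁
  have glue_mem₀ : ∀ bbb {i} (h : i ∈ B₀), glueFun bbb i = (bbb.1.1 ⟨i, h⟩ : ι) :=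
    fun bbb i h => by simp [glueFun, h]
  have glue_mem₁ : ∀ bbb {i} (h : i ∈ B₁), glueFun bbb i = (bbb.1.2 ⟨i, h⟩ : ι) :=
    fun bbb i h => by simp [glueFun, h, hB₁₀ h]
  have glue_mem₂ : ∀ bbb {i} (h : i ∈ (B₀ ∪ B₁)ᶜ), glueFun bbb i = (bbb.2 ⟨i, h⟩ : ι) := by
    intro bbb i h
    have h' := h
    rw [Finset.mem_compl, Finset.mem_union, not_or] at h'
    simp [glueFun, h'.1, h'.2]
  have inv_mem₀ : ∀ bbb {j} (h : j ∈ S), glueInv bbb j = (bbb.1.1.symm ⟨j, h⟩ : ι) :=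
    fun bbb j h => by simp [glueInv, h]
  have inv_mem₁ : ∀ bbb {j} (h : j ∈ T), glueInv bbb j = (bbb.1.2.symm ⟨j, h⟩ : ι) :=
    fun bbb j h => by simp [glueInv, h, hT₀ h]
  have inv_mem₂ : ∀ bbb {j} (h : j ∈ (S ∪ T)ᶜ), glueInv bbb j = (bbb.2.symm ⟨j, h⟩ : ι) := by
    intro bbb j h
    have h' := h
    rw [Finset.mem_compl, Finset.mem_union, not_or] at h'
    simp [glueInv, h'.1, h'.2]
  have hleft : ∀ bbb, Function.LeftInverse (glueInv bbb) (glueFun bbb) := by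
    intro bbb i
    by_cases h₀ : i ∈ B₀
    · rw [glue_mem₀ bbb h₀, inv_mem₀ bbb (bbb.1.1 ⟨i, h₀⟩).2]; simp
    · by_cases h₁ : i ∈ B₁
      · rw [glue_mem₁ bbb h₁, inv_mem₁ bbb (bbb.1.2 ⟨i, h₁⟩).2]; simp
      · have h₂ : i ∈ (B₀ ∪ B₁)ᶜ := by
          rw [Finset.mem_compl, Finset.mem_union]; exact not_or.mpr ⟨h₀, h₁⟩
        rw [glue_mem₂ bbb h₂, inv_mem₂ bbb (bbb.2 ⟨i, h₂⟩).2]; simp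
  have hright : ∀ bbb, Function.RightInverse (glueInv bbb) (glueFun bbb) := by
    intro bbb j
    by_cases h₀ : j ∈ S
    · rw [inv_mem₀ bbb h₀, glue_mem₀ bbb (bbb.1.1.symm ⟨j, h₀⟩).2]; simp
    · by_cases h₁ : j ∈ T
      · rw [inv_mem₁ bbb h₁, glue_mem₁ bbb (bbb.1.2.symm ⟨j, h₁⟩).2]; simp
      · have h₂ : j ∈ (S ∪ T)ᶜ := by
          rw [Finset.mem_compl, Finset.mem_union]; exact not_or.mpr ⟨h₀, h₁⟩
        rw [inv_mem₂ bbb h₂, glue_mem₂ bbb (bbb.2.symm ⟨j, h₂⟩).2]; simp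
  let glue : ((↥B₀ ≃ ↥S) × (↥B₁ ≃ ↥T)) × (↥((B₀ ∪ B₁)ᶜ) ≃ ↥((S ∪ T)ᶜ)) → Equiv.Perm ι :=
    fun bbb => ⟨glueFun bbb, glueInv bbb, hleft bbb, hright bbb⟩
  have glue_apply : ∀ bbb i, glue bbb i = glueFun bbb i := fun _ _ => rfl
  have glue_map₀ : ∀ bbb, B₀.map (glue bbb).toEmbedding = S := by
    intro bbb; ext j
    simp only [Finset.mem_map, Equiv.coe_toEmbedding, glue_apply]
    constructor
    · rintro ⟨p, hp, rfl⟩; rw [glue_mem₀ bbb hp]; exact (bbb.1.1 ⟨p, hp⟩).2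
    · intro hj
      refine ⟨(bbb.1.1.symm ⟨j, hj⟩ : ι), (bbb.1.1.symm ⟨j, hj⟩).2, ?_⟩
      rw [glue_mem₀ bbb (bbb.1.1.symm ⟨j, hj⟩).2]; simp
  have glue_map₁ : ∀ bbb, B₁.map (glue bbb).toEmbedding = T := by
    intro bbb; ext j
    simp only [Finset.mem_map, Equiv.coe_toEmbedding, glue_apply]
    constructor
    · rintro ⟨p, hp, rfl⟩; rw [glue_mem₁ bbb hp]; exact (bbb.1.2 ⟨p, hp⟩).2
    · intro hj
      refine ⟨(bbb.1.2.symm ⟨j, hj⟩ : ι), (bbb.1.2.symm ⟨j, hj⟩).2, ?_⟩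
      rw [glue_mem₁ bbb (bbb.1.2.symm ⟨j, hj⟩).2]; simp
  -- restriction of a permutation of the fibre to the three blocks
  have hfib : ∀ σ : Equiv.Perm ι, σ ∈ (Finset.univ.filter fun σ : Equiv.Perm ι =>
      (B₀.map σ.toEmbedding, B₁.map σ.toEmbedding) = (S, T)) →
      B₀.map σ.toEmbedding = S ∧ B₁.map σ.toEmbedding = T := fun σ hσ =>
    Prod.mk_inj.mp (Finset.mem_filter.mp hσ).2
  have hunion : ∀ {σ : Equiv.Perm ι}, B₀.map σ.toEmbedding = S → B₁.map σ.toEmbedding = T →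
      ∀ i, σ i ∈ (S ∪ T)ᶜ ↔ i ∈ (B₀ ∪ B₁)ᶜ := fun h₀ h₁ i => by
    rw [Finset.mem_compl, Finset.mem_compl, Finset.mem_union, Finset.mem_union,
      perm_mem_iff_of_map_eq h₀, perm_mem_iff_of_map_eq h₁]
  symm
  refine Finset.sum_bij' (fun bbb _ => glue bbb)
    (fun σ hσ =>
      ((σ.subtypeEquiv fun i => (perm_mem_iff_of_map_eq (hfib σ hσ).1 i).symm,
        σ.subtypeEquiv fun i => (perm_mem_iff_of_map_eq (hfib σ hσ).2 i).symm),
        σ.subtypeEquiv fun i => (hunion (hfib σ hσ).1 (hfib σ hσ).2 i).symm))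
    ?_ ?_ ?_ ?_ ?_
  · -- the glued permutation lies in the fibre
    intro bbb _
    exact Finset.mem_filter.mpr ⟨Finset.mem_univ _, Prod.ext (glue_map₀ bbb) (glue_map₁ bbb)⟩
  · intro σ _; simp
  · -- restrict ∘ glue = id
    rintro ⟨⟨b₀, b₁⟩, b₂⟩ _
    refine Prod.ext (Prod.ext ?_ ?_) ?_
    · ext p; simp only [Equiv.subtypeEquiv_apply, glue_apply]; rw [glue_mem₀ _ p.2]
    · ext p; simp only [Equiv.subtypeEquiv_apply, glue_apply]; rw [glue_mem₁ _ p.2]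
    · ext p; simp only [Equiv.subtypeEquiv_apply, glue_apply]; rw [glue_mem₂ _ p.2]
  · -- glue ∘ restrict = id
    intro σ hσ
    ext i
    rw [glue_apply]
    by_cases h₀ : i ∈ B₀
    · rw [glue_mem₀ _ h₀]; simp
    · by_cases h₁ : i ∈ B₁
      · rw [glue_mem₁ _ h₁]; simp
      · have h₂ : i ∈ (B₀ ∪ B₁)ᶜ := by
          rw [Finset.mem_compl, Finset.mem_union]; exact not_or.mpr ⟨h₀, h₁⟩
        rw [glue_mem₂ _ h₂]; simp
  · -- the summands agree
    rintro ⟨⟨b₀, b₁⟩, b₂⟩ _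
    have hsplit : ∏ i, A i (glue ((b₀, b₁), b₂) i) =
        (∏ i ∈ B₀, A i (glue ((b₀, b₁), b₂) i)) * (∏ i ∈ B₁, A i (glue ((b₀, b₁), b₂) i)) *
          ∏ i ∈ (B₀ ∪ B₁)ᶜ, A i (glue ((b₀, b₁), b₂) i) := by
      rw [← Finset.prod_union hB, Finset.prod_mul_prod_compl]
    rw [hsplit, ← Finset.prod_coe_sort B₀, ← Finset.prod_coe_sort B₁,
      ← Finset.prod_coe_sort (B₀ ∪ B₁)ᶜ]
    simp only [glue_apply]
    congr 1
    · congr 1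
      · exact Fintype.prod_congr _ _ fun p => by rw [glue_mem₀ _ p.2]
      · exact Fintype.prod_congr _ _ fun p => by rw [glue_mem₁ _ p.2]
    · exact Fintype.prod_congr _ _ fun p => by rw [glue_mem₂ _ p.2]

end Literature.Combinatorics.Enumerative
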